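import Literature.NumberTheory.LFunctions.HalaszMeanSquare
import Literature.NumberTheory.LFunctions.PrimeNumberTheoremErrorTermProofs
import HarnessLib

/-!
# Granville–Soundararajan 2003, §3b: the sharp `Λ`-weighted mean square and the `G`-mean square

Second file of the proof of Theorem 1 of Granville–Soundararajan (the sharp Halász theorem,
`Literature.NumberTheory.LFunctions.GranvilleSoundararajan.GranvilleSoundararajan2003_theorem1`).
For a `1`-bounded `g : ℕ → ℂ`, `N = ⌊x⌋` and the `(N+1)`-smooth truncation `g̃`
(`Halasz.smoothCut`), the display before (3.14) of the paper is the SHARP bound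
`∫_0^∞ |∑_{n ≤ e^t} g̃(n)Λ(n)|² e^{-2(1+α)t} dt ≤ (1 - x^{-2α})/(2α) + O(1)`,
obtained from the prime number theorem with error `O(y/log² y)` on `t ≤ log x`
(`ChebyshevPsiDeLaValleePoussin_holds.logPow 2`, proved in the tree) and, for `t > log x`, from
the support of `g̃Λ` on powers of primes `p ≤ N`: there `|∑_{n ≤ y} g̃Λ| ≤ ϑ(N) + (ψ(y) − ϑ(y))
≤ (log 4) x + 2√y log y` (Chebyshev; the paper's "`ψ(x) + O(√x)`" must be read this way), whose
contribution after the weight `e^{-2(1+α)t}` is `O(1)`.  (The tree's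
`Halasz.meanSquare_mulVM_le` is the crude version `≤ 18/α` of the same quantity.)
We also record the trivial mean square of `g̃` itself, `∫ |∑_{n ≤ e^u} g̃|² e^{-2(1+α)u} du ≤ 1/(2α)`,
and its Mellin–Plancherel form, used for the window term `∫_{-T}^{T} |G(1+α+iy)/(1+α+iy)|² dy`
of (3.12)–(3.13).

## Main results
- `norm_psum_mulVM_le_theta_add` : `|∑_{n ≤ y} g̃(n)Λ(n)| ≤ ϑ(N) + (ψ(y) − ϑ(y))`.
- `exists_meanSquare_mulVM_le_sharp` : the displayed sharp bound (absolute `O(1)`).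
- `meanSquare_smoothCut_le`, `meanSquare_smoothCut_eq` : `∫ |∑_{n≤e^u} g̃|² e^{-2(1+α)u} ≤ 1/(2α)`
  and `= (1/2π) ∫ |G(1+α+iy)|²/|1+α+iy|² dy`.

## References
- [GranvilleSoundararajan2003] A. Granville, K. Soundararajan, *Decay of mean values of
  multiplicative functions*, Canad. J. Math. 55 (2003), §3b (proof of Lemma 3.2, displays
  (3.13)–(3.14)), arXiv math/9911246 pp. 7–8.

## Design choices
* Integrals over `u ∈ ℝ` of nonnegative integrands are bounded through explicit integrable
  majorants (`integral_mono_of_nonneg`), so no integrability of the integrand is needed.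
* Constants are existential and absolute; `0 < α` (and `α ≤ 1` is not needed here).
-/

noncomputable section

open Finset Real Complex MeasureTheory Filter

namespace Literature.NumberTheory.LFunctions

namespace GranvilleSoundararajan

open Halasz (smoothCut mulVM smoothCut_of_mem smoothCut_of_not_mem norm_smoothCut_le)
open MellinPlancherel (psum)

variable {g : ℕ → ℂ} {N : ℕ}

/-! ### The support bound for `∑_{n ≤ y} g̃(n) Λ(n)` beyond `x` -/

/-- `|∑_{n ≤ y} g̃(n)Λ(n)| ≤ ϑ(N) + (ψ(y) − ϑ(y))`: the primes in the support of `g̃` are `≤ N`, and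
the higher prime powers contribute at most `ψ(y) − ϑ(y)`.
[cite: GranvilleSoundararajan2003, §3b ("since `g(n) = 0` if `n` is divisible by a prime larger than `x` …")] -/
theorem norm_psum_mulVM_le_theta_add (hgb : ∀ n, ‖g n‖ ≤ 1) (y : ℝ) :
    ‖psum (mulVM g N) y‖ ≤ Chebyshev.theta N + (Chebyshev.psi y - Chebyshev.theta y) := by
  classical
  unfold psum
  set Y := ⌊y⌋₊ with hY
  set w : ℕ → ℝ := fun n => if n ∈ Nat.smoothNumbers (N + 1) then ArithmeticFunction.vonMangoldt n else 0
    with hw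
  have hw0 : ∀ n, 0 ≤ w n := fun n => by
    simp only [hw]; split_ifs; exacts [ArithmeticFunction.vonMangoldt_nonneg, le_rfl]
  have hwle : ∀ n, w n ≤ ArithmeticFunction.vonMangoldt n := fun n => by
    simp only [hw]; split_ifs; exacts [le_rfl, ArithmeticFunction.vonMangoldt_nonneg]
  have hterm : ∀ n, ‖mulVM g N n‖ ≤ w n := by
    intro n
    unfold mulVM
    rw [norm_mul, Complex.norm_real, Real.norm_of_nonneg ArithmeticFunction.vonMangoldt_nonneg]
    simp only [hw]
    split_ifs with h
    · exact mul_le_of_le_one_left ArithmeticFunction.vonMangoldt_nonneg (norm_smoothCut_le hgb n)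
    · rw [smoothCut_of_not_mem h, norm_zero, zero_mul]
  have h1 : ‖∑ n ∈ Icc 1 Y, mulVM g N n‖ ≤ ∑ n ∈ Icc 1 Y, w n :=
    (norm_sum_le _ _).trans (Finset.sum_le_sum fun n _ => hterm n)
  refine h1.trans ?_
  rw [← Finset.sum_filter_add_sum_filter_not (Icc 1 Y) Nat.Prime]
  refine add_le_add ?_ ?_
  · -- primes: smooth primes are `≤ N`
    rw [Chebyshev.theta_eq_sum_primesLE_log]
    have hsub : ((Icc 1 Y).filter Nat.Prime).filter (fun n => n ∈ Nat.smoothNumbers (N + 1)) ⊆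
        Nat.primesLE N := by
      intro n hn
      simp only [Finset.mem_filter] at hn
      obtain ⟨⟨-, hp⟩, hs⟩ := hn
      rw [Nat.mem_primesLE]
      refine ⟨?_, hp⟩
      have := (Nat.mem_smoothNumbers.mp hs).2 n ((Nat.mem_primeFactorsList (hp.ne_zero)).mpr ⟨hp, dvd_rfl⟩)
      omega
    calc ∑ n ∈ (Icc 1 Y).filter Nat.Prime, w n
        = ∑ n ∈ ((Icc 1 Y).filter Nat.Prime).filter (fun n => n ∈ Nat.smoothNumbers (N + 1)),
            ArithmeticFunction.vonMangoldt n := by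
          rw [Finset.sum_filter (p := fun n => n ∈ Nat.smoothNumbers (N + 1))]
      _ ≤ ∑ p ∈ Nat.primesLE N, ArithmeticFunction.vonMangoldt p :=
          Finset.sum_le_sum_of_subset_of_nonneg hsub (fun _ _ _ => ArithmeticFunction.vonMangoldt_nonneg)
      _ = ∑ p ∈ Nat.primesLE N, Real.log p := by
          refine Finset.sum_congr rfl fun p hp => ?_
          rw [ArithmeticFunction.vonMangoldt_apply_prime (Nat.mem_primesLE.mp hp).2]
  · -- non-primes: bounded by `ψ(y) − ϑ(y)`
    rw [Chebyshev.psi_sub_theta_eq_sum_not_prime, show Finset.Ioc 0 ⌊y⌋₊ = Finset.Icc 1 Y by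
      ext n; simp only [Finset.mem_Ioc, Finset.mem_Icc, hY]; omega]
    exact Finset.sum_le_sum fun n _ => hwle n

/-- `u² ≤ 8 e^{u/2}` for `u ≥ 0`. [folklore] -/
theorem sq_le_eight_mul_exp_half {u : ℝ} (hu : 0 ≤ u) : u ^ 2 ≤ 8 * Real.exp (u / 2) := by
  have h := Real.quadratic_le_exp_of_nonneg (by linarith : 0 ≤ u / 2)
  nlinarith

/-- The prime number theorem with error `x/log² x` (de la Vallée Poussin, PROVED in the tree as
`ChebyshevPsiDeLaValleePoussin_holds`), upper half: `ψ(y) ≤ y + C y/log² y` for `y ≥ 2`.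
[cite: MontgomeryVaughan2007, Theorem 6.9] -/
theorem exists_psi_le_add_div_log_sq :
    ∃ C : ℝ, 0 ≤ C ∧ ∀ y : ℝ, 2 ≤ y → Chebyshev.psi y ≤ y + C * y / Real.log y ^ 2 := by
  obtain ⟨C, hC⟩ := ChebyshevPsiDeLaValleePoussin_holds.logPow 2
  refine ⟨max C 0, le_max_right _ _, fun y hy => ?_⟩
  have h := hC y hy
  rw [Real.rpow_two] at h
  have hy0 : 0 < y := by linarith
  have hlog : 0 < Real.log y := Real.log_pos (by linarith)
  have h1 : C * y / Real.log y ^ 2 ≤ max C 0 * y / Real.log y ^ 2 := by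
    gcongr; exact le_max_left _ _
  have h2 := (abs_le.mp h).2
  linarith

/-! ### The sharp `Λ`-weighted mean square -/

/-- `∫_ℝ 𝟙_{[0,L]}(u) e^{-cu} du = (1 - e^{-cL})/c` for `L ≥ 0`, `c > 0`. [folklore] -/
theorem integral_indicator_Icc_exp_neg {L c : ℝ} (hL : 0 ≤ L) (hc : 0 < c) :
    ∫ u : ℝ, (Set.Icc 0 L).indicator (fun u => Real.exp (-c * u)) u = (1 - Real.exp (-c * L)) / c := by
  rw [integral_indicator measurableSet_Icc, integral_Icc_eq_integral_Ioc,
    ← intervalIntegral.integral_of_le hL,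
    intervalIntegral.integral_comp_mul_left (f := Real.exp) (by linarith : -c ≠ 0), integral_exp]
  simp only [mul_zero, Real.exp_zero, smul_eq_mul]
  field_simp
  ring

/-- `log 4 ≤ 7/5`. [folklore] -/
theorem log_four_le : Real.log 4 ≤ 7 / 5 := by
  have hlog2' : Real.log 2 < 0.6931471808 := Real.log_two_lt_d9
  rw [show (4 : ℝ) = 2 ^ 2 by norm_num, Real.log_pow]; push_cast; linarith

/-- The arithmetic of the tail `u > log x`: if `0 ≤ P ≤ (log 4) x + 2 e^{u/2} u` with `u > 0`, `α > 0`,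
then `P² e^{-2(1+α)u} ≤ 4x² e^{-2u} + 64 e^{-u/2}`. [folklore] -/
theorem tail_weight_bound {x u α P : ℝ} (hu : 0 < u) (hα : 0 < α) (hP0 : 0 ≤ P)
    (hP : P ≤ Real.log 4 * x + 2 * Real.exp (u / 2) * u) :
    P ^ 2 * Real.exp (-(2 * (1 + α) * u)) ≤
      4 * x ^ 2 * Real.exp (-2 * u) + 64 * Real.exp (-(1 / 2) * u) := by
  set a := Real.log 4 * x with ha
  set b := 2 * Real.exp (u / 2) * u with hb
  have hlog4 := log_four_le
  have hlog40 : 0 ≤ Real.log 4 := Real.log_nonneg (by norm_num)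
  have hw : Real.exp (-(2 * (1 + α) * u)) ≤ Real.exp (-2 * u) := by
    rw [Real.exp_le_exp]; nlinarith
  have hsq8 := sq_le_eight_mul_exp_half hu.le
  have he2 : Real.exp u * Real.exp (-2 * u) = Real.exp (-u) := by
    rw [← Real.exp_add]; ring_nf
  have he3 : Real.exp (u / 2) * Real.exp (-u) = Real.exp (-(1 / 2) * u) := by
    rw [← Real.exp_add]; ring_nf
  have hb2 : b ^ 2 = 4 * Real.exp u * u ^ 2 := by
    rw [hb, mul_pow, mul_pow, sq (Real.exp (u / 2)), ← Real.exp_add, show u / 2 + u / 2 = u by ring]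
    ring
  have hl2 : Real.log 4 ^ 2 ≤ 49 / 25 := by nlinarith
  have ha2 : a ^ 2 ≤ 49 / 25 * x ^ 2 := by
    rw [ha, mul_pow]; nlinarith [sq_nonneg x]
  have hsumsq : P ^ 2 ≤ 98 / 25 * x ^ 2 + 8 * Real.exp u * u ^ 2 := by
    have h1 : P ^ 2 ≤ (a + b) ^ 2 := pow_le_pow_left₀ hP0 hP 2
    have h2 : (a + b) ^ 2 ≤ 2 * a ^ 2 + 2 * b ^ 2 := by nlinarith [sq_nonneg (a - b)]
    rw [hb2] at h2
    linarith
  calc P ^ 2 * Real.exp (-(2 * (1 + α) * u))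
      ≤ (98 / 25 * x ^ 2 + 8 * Real.exp u * u ^ 2) * Real.exp (-2 * u) :=
        mul_le_mul hsumsq hw (Real.exp_pos _).le (by positivity)
    _ = 98 / 25 * x ^ 2 * Real.exp (-2 * u) + 8 * u ^ 2 * (Real.exp u * Real.exp (-2 * u)) := by ring
    _ = 98 / 25 * x ^ 2 * Real.exp (-2 * u) + 8 * u ^ 2 * Real.exp (-u) := by rw [he2]
    _ ≤ 4 * x ^ 2 * Real.exp (-2 * u) + 8 * (8 * Real.exp (u / 2)) * Real.exp (-u) := by
        refine add_le_add ?_ ?_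
        · exact mul_le_mul_of_nonneg_right (by nlinarith [sq_nonneg x]) (Real.exp_pos _).le
        · exact mul_le_mul_of_nonneg_right (by linarith) (Real.exp_pos _).le
    _ = 4 * x ^ 2 * Real.exp (-2 * u) + 64 * (Real.exp (u / 2) * Real.exp (-u)) := by ring
    _ = 4 * x ^ 2 * Real.exp (-2 * u) + 64 * Real.exp (-(1 / 2) * u) := by rw [he3]

/-- **Granville–Soundararajan's sharp `Λ`-mean square** (display before (3.14)): there is an
absolute `C₅` such that for every `1`-bounded `g`, `x ≥ 3`, `N = ⌊x⌋` and `α > 0`,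
`∫_ℝ |∑_{n ≤ e^u} g̃(n)Λ(n)|² e^{-2(1+α)u} du ≤ (1 − x^{-2α})/(2α) + C₅`.
On `log 2 ≤ u ≤ log x` the integrand is `≤ ψ(e^u)² e^{-2(1+α)u} ≤ (1 + C/u²)² e^{-2αu}`
(prime number theorem), on `u > log x` it is `≤ ((log 4)x + 2 e^{u/2} u)² e^{-2u}`
(`norm_psum_mulVM_le_theta_add`, Chebyshev), and it vanishes for `u < log 2`.
[cite: GranvilleSoundararajan2003, §3b, display before (3.14)] -/
theorem exists_meanSquare_mulVM_le_sharp :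
    ∃ C₅ : ℝ, 0 ≤ C₅ ∧ ∀ g : ℕ → ℂ, (∀ n, ‖g n‖ ≤ 1) → ∀ x : ℝ, 3 ≤ x → ∀ α : ℝ, 0 < α →
      ∫ u : ℝ, ‖psum (mulVM g ⌊x⌋₊) (Real.exp u)‖ ^ 2 * Real.exp (-(2 * (1 + α) * u)) ≤
        (1 - x ^ (-(2 * α))) / (2 * α) + C₅ := by
  obtain ⟨C, hC0, hC⟩ := exists_psi_le_add_div_log_sq
  have hlog2 : (0.6931471803 : ℝ) < Real.log 2 := Real.log_two_gt_d9
  have hlog2' : Real.log 2 < 0.6931471808 := Real.log_two_lt_d9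
  set D : ℝ := 2 * C + C ^ 2 / Real.log 2 ^ 2 with hD
  have hD0 : 0 ≤ D := by positivity
  refine ⟨2 * D / Real.log 2 + 130, by positivity, fun g hgb x hx α hα => ?_⟩
  set N := ⌊x⌋₊ with hN
  have hx0 : 0 < x := by linarith
  have hx1 : 1 ≤ x := by linarith
  have hlx : 1 < Real.log x := by
    rw [Real.lt_log_iff_exp_lt hx0]
    exact lt_of_lt_of_le (by have := Real.exp_one_lt_d9; linarith) hx
  have hNx : (N : ℝ) ≤ x := Nat.floor_le hx0.le
  -- the three majorants
  set F₁ : ℝ → ℝ := (Set.Icc 0 (Real.log x)).indicator (fun u => Real.exp (-(2 * α) * u)) with hF₁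
  set F₂ : ℝ → ℝ := (Set.Ioi (Real.log 2 / 2)).indicator (fun u => D * u ^ (-2 : ℝ)) with hF₂
  set F₃ : ℝ → ℝ := (Set.Ioi (Real.log x)).indicator
    (fun u => 4 * x ^ 2 * Real.exp (-2 * u) + 64 * Real.exp (-(1 / 2) * u)) with hF₃
  have hF₁0 : ∀ u, 0 ≤ F₁ u := fun u => by
    simp only [hF₁]; exact Set.indicator_nonneg (fun _ _ => (Real.exp_pos _).le) _
  have hF₂0 : ∀ u, 0 ≤ F₂ u := fun u => by
    simp only [hF₂]
    refine Set.indicator_nonneg (fun v hv => ?_) _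
    have : 0 < v := lt_trans (by linarith) (Set.mem_Ioi.mp hv)
    exact mul_nonneg hD0 (Real.rpow_nonneg this.le _)
  have hF₃0 : ∀ u, 0 ≤ F₃ u := fun u => by
    simp only [hF₃]; exact Set.indicator_nonneg (fun _ _ => by positivity) _
  -- integrability
  have hF₁i : Integrable F₁ := by
    simp only [hF₁]
    rw [integrable_indicator_iff measurableSet_Icc]
    exact (by fun_prop : Continuous fun u => Real.exp (-(2 * α) * u)).continuousOn.integrableOn_Icc
  have hF₂i : Integrable F₂ := by
    simp only [hF₂]
    rw [integrable_indicator_iff measurableSet_Ioi]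
    exact (integrableOn_Ioi_rpow_of_lt (by norm_num : (-2 : ℝ) < -1) (by linarith)).const_mul D
  have hF₃i : Integrable F₃ := by
    simp only [hF₃]
    rw [integrable_indicator_iff measurableSet_Ioi]
    exact ((integrableOn_exp_mul_Ioi (by norm_num : (-2 : ℝ) < 0) _).const_mul _).add
      ((integrableOn_exp_mul_Ioi (by norm_num : (-(1 / 2) : ℝ) < 0) _).const_mul _)
  -- the pointwise bound
  have hpt : ∀ u : ℝ, ‖psum (mulVM g N) (Real.exp u)‖ ^ 2 * Real.exp (-(2 * (1 + α) * u)) ≤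
      F₁ u + F₂ u + F₃ u := by
    intro u
    have hψ := Halasz.norm_psum_mulVM_le_psi (N := N) hgb (Real.exp u)
    rcases lt_or_ge u (Real.log 2) with hu2 | hu2
    · -- `e^u < 2`: the sum vanishes
      have h2 : Real.exp u < 2 := by
        calc Real.exp u < Real.exp (Real.log 2) := Real.exp_lt_exp.mpr hu2
          _ = 2 := Real.exp_log (by norm_num)
      rw [Chebyshev.psi_eq_zero_of_lt_two h2] at hψ
      have h0 : ‖psum (mulVM g N) (Real.exp u)‖ = 0 := le_antisymm hψ (norm_nonneg _)
      rw [h0]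
      simp only [ne_eq, OfNat.ofNat_ne_zero, not_false_eq_true, zero_pow, zero_mul]
      linarith [hF₁0 u, hF₂0 u, hF₃0 u]
    have hu0 : 0 < u := by linarith
    rcases le_or_gt u (Real.log x) with hux | hux
    · -- `log 2 ≤ u ≤ log x`: prime number theorem
      have hy2 : (2 : ℝ) ≤ Real.exp u := by
        calc (2 : ℝ) = Real.exp (Real.log 2) := (Real.exp_log (by norm_num)).symm
          _ ≤ Real.exp u := Real.exp_le_exp.mpr hu2
      have hpnt := hC (Real.exp u) hy2
      rw [Real.log_exp] at hpnt
      have hbound : ‖psum (mulVM g N) (Real.exp u)‖ ≤ Real.exp u * (1 + C / u ^ 2) := by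
        have : Real.exp u * (1 + C / u ^ 2) = Real.exp u + C * Real.exp u / u ^ 2 := by ring
        rw [this]
        exact hψ.trans hpnt
      have hc0 : 0 ≤ C / u ^ 2 := by positivity
      have he1 : Real.exp (-(2 * α) * u) ≤ 1 := by
        rw [Real.exp_le_one_iff]; nlinarith
      have he0 : 0 < Real.exp (-(2 * α) * u) := Real.exp_pos _
      have hF₁u : F₁ u = Real.exp (-(2 * α) * u) := by
        simp only [hF₁]; rw [Set.indicator_of_mem (Set.mem_Icc.mpr ⟨hu0.le, hux⟩)]
      have hF₂u : F₂ u = D * u ^ (-2 : ℝ) := by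
        simp only [hF₂]; rw [Set.indicator_of_mem (Set.mem_Ioi.mpr (by linarith))]
      have hu2' : u ^ (-2 : ℝ) = (u ^ 2)⁻¹ := by
        rw [Real.rpow_neg hu0.le, Real.rpow_two]
      -- `(1 + C/u²)² - 1 ≤ D/u²` since `u ≥ log 2`
      have hDu : (1 + C / u ^ 2) ^ 2 - 1 ≤ D * (u ^ 2)⁻¹ := by
        have hu2sq : Real.log 2 ^ 2 ≤ u ^ 2 := pow_le_pow_left₀ (by linarith) hu2 2
        have hl0 : 0 < Real.log 2 ^ 2 := by positivity
        have hu20 : 0 < u ^ 2 := by positivity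
        have hkey : C ^ 2 / (u ^ 2) ^ 2 ≤ C ^ 2 / Real.log 2 ^ 2 / u ^ 2 := by
          rw [div_div, sq (u ^ 2)]
          exact div_le_div_of_nonneg_left (sq_nonneg C) (by positivity)
            (mul_le_mul_of_nonneg_right hu2sq hu20.le)
        have hexp : (1 + C / u ^ 2) ^ 2 - 1 = 2 * C / u ^ 2 + C ^ 2 / (u ^ 2) ^ 2 := by
          field_simp; ring
        have hrhs : D * (u ^ 2)⁻¹ = 2 * C / u ^ 2 + C ^ 2 / Real.log 2 ^ 2 / u ^ 2 := by
          rw [hD]; field_simp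
        rw [hexp, hrhs]
        linarith
      have hmain : (Real.exp u * (1 + C / u ^ 2)) ^ 2 * Real.exp (-(2 * (1 + α) * u)) =
          (1 + C / u ^ 2) ^ 2 * Real.exp (-(2 * α) * u) := by
        have h' : Real.exp u ^ 2 * Real.exp (-(2 * (1 + α) * u)) = Real.exp (-(2 * α) * u) := by
          rw [sq, ← Real.exp_add, ← Real.exp_add]; congr 1; ring
        rw [mul_pow, mul_comm (Real.exp u ^ 2), mul_assoc, h']
      calc ‖psum (mulVM g N) (Real.exp u)‖ ^ 2 * Real.exp (-(2 * (1 + α) * u))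
          ≤ (Real.exp u * (1 + C / u ^ 2)) ^ 2 * Real.exp (-(2 * (1 + α) * u)) := by
            gcongr
        _ = (1 + C / u ^ 2) ^ 2 * Real.exp (-(2 * α) * u) := hmain
        _ = Real.exp (-(2 * α) * u) + ((1 + C / u ^ 2) ^ 2 - 1) * Real.exp (-(2 * α) * u) := by ring
        _ ≤ Real.exp (-(2 * α) * u) + ((1 + C / u ^ 2) ^ 2 - 1) * 1 := by
            gcongr
            nlinarith
        _ ≤ F₁ u + F₂ u := by rw [hF₁u, hF₂u, hu2', mul_one]; linarith
        _ ≤ F₁ u + F₂ u + F₃ u := by linarith [hF₃0 u]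
    · -- `u > log x`: support bound
      have hexu : x < Real.exp u := by
        calc x = Real.exp (Real.log x) := (Real.exp_log hx0).symm
          _ < Real.exp u := Real.exp_lt_exp.mpr hux
      have h1e : (1 : ℝ) ≤ Real.exp u := by linarith
      have hsupp := norm_psum_mulVM_le_theta_add (N := N) hgb (Real.exp u)
      have hθN : Chebyshev.theta N ≤ Real.log 4 * x :=
        (Chebyshev.theta_le_log4_mul_x (Nat.cast_nonneg N)).trans
          (mul_le_mul_of_nonneg_left hNx (Real.log_nonneg (by norm_num)))
      have hdiff := Chebyshev.abs_psi_sub_theta_le_sqrt_mul_log h1e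
      rw [Real.log_exp] at hdiff
      have hdiff' := (abs_le.mp hdiff).2
      have hsq : Real.sqrt (Real.exp u) = Real.exp (u / 2) := by
        rw [Real.sqrt_eq_rpow, ← Real.exp_mul]; ring_nf
      rw [hsq] at hdiff'
      have hnorm : ‖psum (mulVM g N) (Real.exp u)‖ ≤ Real.log 4 * x + 2 * Real.exp (u / 2) * u := by
        linarith
      have hF₃u : F₃ u = 4 * x ^ 2 * Real.exp (-2 * u) + 64 * Real.exp (-(1 / 2) * u) := by
        simp only [hF₃]; rw [Set.indicator_of_mem (Set.mem_Ioi.mpr hux)]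
      calc ‖psum (mulVM g N) (Real.exp u)‖ ^ 2 * Real.exp (-(2 * (1 + α) * u))
          ≤ 4 * x ^ 2 * Real.exp (-2 * u) + 64 * Real.exp (-(1 / 2) * u) :=
            tail_weight_bound hu0 hα (norm_nonneg _) hnorm
        _ = F₃ u := hF₃u.symm
        _ ≤ F₁ u + F₂ u + F₃ u := by linarith [hF₁0 u, hF₂0 u]
  -- integrate the majorants
  have hI₁ : ∫ u, F₁ u = (1 - x ^ (-(2 * α))) / (2 * α) := by
    simp only [hF₁]
    rw [integral_indicator_Icc_exp_neg (by linarith) (by positivity : 0 < 2 * α),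
      Real.rpow_def_of_pos hx0]
    congr 3
    ring
  have hI₂ : ∫ u, F₂ u = D * (2 / Real.log 2) := by
    simp only [hF₂]
    rw [integral_indicator measurableSet_Ioi, integral_const_mul,
      integral_Ioi_rpow_of_lt (by norm_num : (-2 : ℝ) < -1) (by linarith)]
    congr 1
    rw [show (-2 : ℝ) + 1 = -1 by norm_num, Real.rpow_neg_one]
    field_simp
  have hI₃ : ∫ u, F₃ u ≤ 130 := by
    simp only [hF₃]
    rw [integral_indicator measurableSet_Ioi,
      integral_add ((integrableOn_exp_mul_Ioi (by norm_num : (-2 : ℝ) < 0) _).const_mul _)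
        ((integrableOn_exp_mul_Ioi (by norm_num : (-(1 / 2) : ℝ) < 0) _).const_mul _),
      integral_const_mul, integral_const_mul, integral_exp_mul_Ioi (by norm_num : (-2 : ℝ) < 0),
      integral_exp_mul_Ioi (by norm_num : (-(1 / 2) : ℝ) < 0)]
    have h1 : Real.exp (-2 * Real.log x) = (x ^ 2)⁻¹ := by
      rw [show -2 * Real.log x = -(Real.log (x ^ 2)) by rw [Real.log_pow]; push_cast; ring,
        Real.exp_neg, Real.exp_log (by positivity)]
    have h2 : Real.exp (-(1 / 2) * Real.log x) ≤ 1 := by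
      rw [Real.exp_le_one_iff]
      have := Real.log_nonneg hx1
      nlinarith
    rw [h1]
    have hx2 : 0 < x ^ 2 := by positivity
    calc 4 * x ^ 2 * (-(x ^ 2)⁻¹ / -2) + 64 * (-Real.exp (-(1 / 2) * Real.log x) / -(1 / 2))
        = 2 * (x ^ 2 * (x ^ 2)⁻¹) + 128 * Real.exp (-(1 / 2) * Real.log x) := by ring
      _ ≤ 2 * 1 + 128 * 1 := by
          gcongr
          rw [mul_inv_cancel₀ hx2.ne']
      _ = 130 := by norm_num
  have hnonneg : 0 ≤ᵐ[volume] fun u : ℝ =>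
      ‖psum (mulVM g N) (Real.exp u)‖ ^ 2 * Real.exp (-(2 * (1 + α) * u)) :=
    Filter.Eventually.of_forall fun u => by positivity
  calc ∫ u : ℝ, ‖psum (mulVM g N) (Real.exp u)‖ ^ 2 * Real.exp (-(2 * (1 + α) * u))
      ≤ ∫ u, (F₁ u + F₂ u + F₃ u) :=
        integral_mono_of_nonneg hnonneg ((hF₁i.add hF₂i).add hF₃i) (Filter.Eventually.of_forall hpt)
    _ = (∫ u, F₁ u) + (∫ u, F₂ u) + ∫ u, F₃ u := by
        rw [integral_add (f := fun u => F₁ u + F₂ u) (g := F₃) (hF₁i.add hF₂i) hF₃i,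
          integral_add hF₁i hF₂i]
    _ ≤ (1 - x ^ (-(2 * α))) / (2 * α) + D * (2 / Real.log 2) + 130 := by
        rw [hI₁, hI₂]; linarith
    _ = (1 - x ^ (-(2 * α))) / (2 * α) + (2 * D / Real.log 2 + 130) := by ring

/-! ### The trivial mean square of `g̃` and its Mellin–Plancherel form -/

/-- `|∑_{n ≤ y} g̃(n)| ≤ y` for `y ≥ 1`, in the form needed by `MellinPlancherel`. [folklore] -/
theorem norm_psum_smoothCut_le (hgb : ∀ n, ‖g n‖ ≤ 1) (y : ℝ) (hy : 1 ≤ y) :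
    ‖psum (smoothCut g N) y‖ ≤ 1 * y ^ (1 : ℝ) := by
  rw [one_mul, Real.rpow_one]
  unfold psum
  have hy0 : 0 ≤ y := by linarith
  calc ‖∑ n ∈ Icc 1 ⌊y⌋₊, smoothCut g N n‖ ≤ ∑ n ∈ Icc 1 ⌊y⌋₊, ‖smoothCut g N n‖ := norm_sum_le _ _
    _ ≤ ∑ n ∈ Icc 1 ⌊y⌋₊, (1 : ℝ) := Finset.sum_le_sum fun n _ => norm_smoothCut_le hgb n
    _ = ⌊y⌋₊ := by simp
    _ ≤ y := Nat.floor_le hy0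

/-- `∑ |g̃(n)| n^{-σ} < ∞` for `σ > 1` (comparison with `∑ n^{-σ}`). [folklore] -/
theorem summable_norm_smoothCut_div_rpow' (hgb : ∀ n, ‖g n‖ ≤ 1) {σ : ℝ} (hσ : 1 < σ) :
    Summable fun n : ℕ => ‖smoothCut g N n‖ / (n : ℝ) ^ σ := by
  refine Summable.of_nonneg_of_le (fun n => by positivity) (fun n => ?_)
    (Real.summable_one_div_nat_rpow.mpr hσ)
  exact div_le_div_of_nonneg_right (norm_smoothCut_le hgb n) (by positivity)

/-- **The mean square of `g̃`**: `∫_ℝ |∑_{n ≤ e^u} g̃(n)|² e^{-2(1+α)u} du ≤ 1/(2α)` (`α > 0`).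
[cite: GranvilleSoundararajan2003, (3.13)] -/
theorem meanSquare_smoothCut_le (hgb : ∀ n, ‖g n‖ ≤ 1) {α : ℝ} (hα : 0 < α) :
    ∫ u : ℝ, ‖psum (smoothCut g N) (Real.exp u)‖ ^ 2 * Real.exp (-(2 * (1 + α) * u)) ≤ 1 / (2 * α) := by
  set F : ℝ → ℝ := (Set.Ici (0 : ℝ)).indicator (fun u => Real.exp (-(2 * α) * u)) with hF
  have hIoi : IntegrableOn (fun u => Real.exp (-(2 * α) * u)) (Set.Ioi (0 : ℝ)) :=
    integrableOn_exp_mul_Ioi (by linarith : -(2 * α) < 0) 0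
  have hIci : IntegrableOn (fun u => Real.exp (-(2 * α) * u)) (Set.Ici (0 : ℝ)) :=
    (integrableOn_Ici_iff_integrableOn_Ioi).2 hIoi
  have hFint : Integrable F := by
    rw [hF, integrable_indicator_iff measurableSet_Ici]
    exact hIci
  have hle : ∀ u : ℝ,
      ‖psum (smoothCut g N) (Real.exp u)‖ ^ 2 * Real.exp (-(2 * (1 + α) * u)) ≤ F u := by
    intro u
    by_cases hu : 0 ≤ u
    · rw [hF, Set.indicator_of_mem (Set.mem_Ici.2 hu)]
      have h1 : (1 : ℝ) ≤ Real.exp u := by simpa using Real.one_le_exp hu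
      have hb := norm_psum_smoothCut_le (N := N) hgb (Real.exp u) h1
      rw [one_mul, Real.rpow_one] at hb
      have hexp : (Real.exp u) ^ 2 * Real.exp (-(2 * (1 + α) * u)) = Real.exp (-(2 * α) * u) := by
        rw [sq (Real.exp u), ← Real.exp_add, ← Real.exp_add]
        congr 1; ring
      calc ‖psum (smoothCut g N) (Real.exp u)‖ ^ 2 * Real.exp (-(2 * (1 + α) * u))
          ≤ (Real.exp u) ^ 2 * Real.exp (-(2 * (1 + α) * u)) := by gcongr
        _ = Real.exp (-(2 * α) * u) := hexp
    · push Not at hu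
      rw [hF, Set.indicator_of_notMem (by simpa using hu),
        MellinPlancherel.psum_of_lt_one _ (by simpa using Real.exp_lt_one_iff.mpr hu)]
      simp
  have hnonneg : 0 ≤ᵐ[volume] fun u : ℝ =>
      ‖psum (smoothCut g N) (Real.exp u)‖ ^ 2 * Real.exp (-(2 * (1 + α) * u)) :=
    Filter.Eventually.of_forall fun u => by positivity
  calc ∫ u : ℝ, ‖psum (smoothCut g N) (Real.exp u)‖ ^ 2 * Real.exp (-(2 * (1 + α) * u))
      ≤ ∫ u, F u := integral_mono_of_nonneg hnonneg hFint (Filter.Eventually.of_forall hle)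
    _ = 1 / (2 * α) := by
        rw [hF, integral_indicator measurableSet_Ici, integral_Ici_eq_integral_Ioi,
          integral_exp_mul_Ioi (by linarith : -(2 * α) < 0) 0]
        simp only [mul_zero, Real.exp_zero]
        field_simp

/-- **Mellin–Plancherel for `g̃`**:
`∫ |∑_{n ≤ e^u} g̃|² e^{-2(1+α)u} du = (1/2π) ∫ |G(1+α+iy)|²/|1+α+iy|² dy`, `G(s) = ∑ g̃(n) n^{-s}`.
[cite: GranvilleSoundararajan2003, §3b (3.13)] -/
theorem meanSquare_smoothCut_eq (hgb : ∀ n, ‖g n‖ ≤ 1) {α : ℝ} (hα : 0 < α) :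
    ∫ u : ℝ, ‖psum (smoothCut g N) (Real.exp u)‖ ^ 2 * Real.exp (-(2 * (1 + α) * u)) =
      (1 / (2 * π)) * ∫ y : ℝ, ‖LSeries (smoothCut g N) (1 + α + y * I)‖ ^ 2 /
        ‖(1 : ℂ) + α + y * I‖ ^ 2 := by
  have h := MellinPlancherel.integral_norm_sq_psum_exp (a := smoothCut g N) (σ := 1 + α)
    (θ := 1) (C := 1) (by linarith) (summable_norm_smoothCut_div_rpow' hgb (by linarith))
    (by linarith) (fun y hy => norm_psum_smoothCut_le hgb y hy)
  simpa only [Halasz.ofReal_one_add] using h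

/-- `y ↦ |G(1+α+iy)|²/|1+α+iy|²` is integrable over `ℝ` (`0 < α`). [folklore] -/
theorem integrable_normSq_smoothCut_div (hgb : ∀ n, ‖g n‖ ≤ 1) {α : ℝ} (hα : 0 < α) :
    Integrable (fun y : ℝ => ‖LSeries (smoothCut g N) (1 + α + y * I)‖ ^ 2 / ‖(1 : ℂ) + α + y * I‖ ^ 2) := by
  have h := Halasz.integrable_norm_LSeries_sq_div (a := smoothCut g N) (σ := 1 + α) (by linarith)
    (summable_norm_smoothCut_div_rpow' hgb (by linarith))
  simpa only [Halasz.ofReal_one_add] using h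

/-- **The `G`-window bound** (GS03 (3.13), all of `ℝ` instead of `[-T, T]`):
`∫_ℝ |G(1+α+iy)|²/|1+α+iy|² dy ≤ π/α`. [cite: GranvilleSoundararajan2003, (3.13)] -/
theorem integral_normSq_smoothCut_div_le (hgb : ∀ n, ‖g n‖ ≤ 1) {α : ℝ} (hα : 0 < α) :
    ∫ y : ℝ, ‖LSeries (smoothCut g N) (1 + α + y * I)‖ ^ 2 / ‖(1 : ℂ) + α + y * I‖ ^ 2 ≤ π / α := by
  have h1 := meanSquare_smoothCut_eq (N := N) hgb hα
  have h2 := meanSquare_smoothCut_le (N := N) hgb hα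
  rw [h1] at h2
  have hπ : 0 < 2 * π := by positivity
  calc ∫ y : ℝ, ‖LSeries (smoothCut g N) (1 + α + y * I)‖ ^ 2 / ‖(1 : ℂ) + α + y * I‖ ^ 2
      = 2 * π * (1 / (2 * π) * ∫ y : ℝ, ‖LSeries (smoothCut g N) (1 + α + y * I)‖ ^ 2 /
          ‖(1 : ℂ) + α + y * I‖ ^ 2) := by rw [← mul_assoc, mul_one_div_cancel hπ.ne', one_mul]
    _ ≤ 2 * π * (1 / (2 * α)) := by gcongr
    _ = π / α := by field_simp

end GranvilleSoundararajan

end Literature.NumberTheory.LFunctions
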